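import Summits.Parity.GeneralizedHardyLittlewood.Theorems.PrimeLevelFamEdgeIdeaDeltasPeterssonLayersBands
import HarnessLib

/-!
# Route `PrimeLevelFamEdge`, crux K_A `MomentsBeyondDiagonal` (stmt-Parity-20007), line «petersson_layers» v4:
# WINDOW GLUE — a piece that is `O(q̂ log⁻³ q̂)` on SOME short window `(1, Δ₀]` has the printed shape with `t = 0`

The deck's piece statements are ∃-window statements: `SubOf F := ∃ Δ > 1, ∃ t, HasShape F Δ t`.  The print band of
`stub_farP` (`SubBand rhoP rhoWeil`, by famedge-1's `subFar_rhoP_of_band`) is expected with `t = 0`, and the repaired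
pencil (this hand's census on the crux item: balanced `(u,v)`-regrouping + Pascadi Thm 7.1 + coprimality bookkeeping)
delivers a plain norm bound `‖BAND‖ ≤ C q̂ log⁻³ q̂` only on a SHORT window `Δ' ∈ (1, 1 + λ₀]`.  This file records the
(trivial but load-bearing) glue: such a bound on any window `(1, Δ₀]`, `Δ₀ > 1`, IS `SubOf` (`subOf_of_norm_le_window`),
specialised to the band, the far layers and the upper layers (`subBand_of_norm_le_window`, `subFar_of_norm_le_window`,
`subUpper_of_norm_le_window`).  Nothing else: no layer is bounded here; K_A NOT proved; nothing about Landau–Siegel zeros.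
-/

noncomputable section

open Finset Polynomial
open Literature.NumberTheory.LFunctions

namespace Summit.Parity.GeneralizedHardyLittlewood.Theorems.MomentsBeyondDiagonal.Layers

open Summit.Parity.GeneralizedHardyLittlewood.Theorems.PrimeLevelFamEdgeIdeaDeltas.PeterssonLayers

/-- **Window glue**: if on some window `(1, Δ₀]` (`Δ₀ > 1`), for every admissible `P`, even-or-odd `Q` and `Δ'` in the
window there are `C, q₀` with `‖F q P Q Δ'‖ ≤ C q̂ (log q̂)⁻³` for all primes `q ≥ q₀` (with `q̂^{Δ'} ∉ ℕ`), then `F` has the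
second-display shape with the functional `t = 0`: `SubOf F`. [folklore] -/
theorem subOf_of_norm_le_window (F : LevelFamily) {Δ₀ : ℝ} (hΔ₀ : 1 < Δ₀)
    (h : ∀ P Q : ℝ[X], KMV2000.Admissible P → KMV2000.IsEvenOrOdd Q → ∀ Δ' : ℝ, 1 < Δ' → Δ' ≤ Δ₀ →
      ∃ C : ℝ, ∃ q₀ : ℕ, ∀ (q : ℕ) [NeZero q], q.Prime → q₀ ≤ q →
        (∀ n : ℕ, (n : ℝ) ≠ KMV2000.qhat q ^ Δ') →
          ‖F q P Q Δ'‖ ≤ C * KMV2000.qhat q * (Real.log (KMV2000.qhat q))⁻¹ ^ 3) :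
    SubOf F := by
  refine ⟨Δ₀, hΔ₀, fun _ _ _ ↦ 0, ?_⟩
  intro P Q hP hQ Δ' h1 h2
  obtain ⟨C, q₀, hC⟩ := h P Q hP hQ Δ' h1 h2
  refine ⟨C, q₀, fun q _ hq hq₀ hM ↦ ?_⟩
  have e : F q P Q Δ' -
      ((2 * riemannZeta 2 ^ 2 * ((KMV2000.qhat q / (Δ' ^ 2 * Real.log (KMV2000.qhat q) ^ 2) : ℝ) : ℂ)) *
        (((0 : ℝ) : ℝ) : ℂ)) = F q P Q Δ' := by
    push_cast
    ring
  rw [e]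
  exact hC q hq hq₀ hM

/-- **The band piece from a window bound** (`t = 0`): for any cuts `ρ₁, ρ₂`. [folklore] -/
theorem subBand_of_norm_le_window (ρ₁ ρ₂ : ℝ → ℝ) {Δ₀ : ℝ} (hΔ₀ : 1 < Δ₀)
    (h : ∀ P Q : ℝ[X], KMV2000.Admissible P → KMV2000.IsEvenOrOdd Q → ∀ Δ' : ℝ, 1 < Δ' → Δ' ≤ Δ₀ →
      ∃ C : ℝ, ∃ q₀ : ℕ, ∀ (q : ℕ) [NeZero q], q.Prime → q₀ ≤ q →
        (∀ n : ℕ, (n : ℝ) ≠ KMV2000.qhat q ^ Δ') →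
          ‖band q ρ₁ ρ₂ P Q Δ'‖ ≤ C * KMV2000.qhat q * (Real.log (KMV2000.qhat q))⁻¹ ^ 3) :
    SubBand ρ₁ ρ₂ :=
  subOf_of_norm_le_window (fun q _ P Q Δ' ↦ band q ρ₁ ρ₂ P Q Δ') hΔ₀ h

/-- **The far piece from a window bound** (`t = 0`): for any cut `ρ`. [folklore] -/
theorem subFar_of_norm_le_window (ρ : ℝ → ℝ) {Δ₀ : ℝ} (hΔ₀ : 1 < Δ₀)
    (h : ∀ P Q : ℝ[X], KMV2000.Admissible P → KMV2000.IsEvenOrOdd Q → ∀ Δ' : ℝ, 1 < Δ' → Δ' ≤ Δ₀ →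
      ∃ C : ℝ, ∃ q₀ : ℕ, ∀ (q : ℕ) [NeZero q], q.Prime → q₀ ≤ q →
        (∀ n : ℕ, (n : ℝ) ≠ KMV2000.qhat q ^ Δ') →
          ‖farLayers q ρ P Q Δ'‖ ≤ C * KMV2000.qhat q * (Real.log (KMV2000.qhat q))⁻¹ ^ 3) :
    SubFar ρ :=
  subOf_of_norm_le_window (fun q _ P Q Δ' ↦ farLayers q ρ P Q Δ') hΔ₀ h

/-- **The upper-layer piece from a window bound** (`t = 0`): for any cut `ρ`. [folklore] -/
theorem subUpper_of_norm_le_window (ρ : ℝ → ℝ) {Δ₀ : ℝ} (hΔ₀ : 1 < Δ₀)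
    (h : ∀ P Q : ℝ[X], KMV2000.Admissible P → KMV2000.IsEvenOrOdd Q → ∀ Δ' : ℝ, 1 < Δ' → Δ' ≤ Δ₀ →
      ∃ C : ℝ, ∃ q₀ : ℕ, ∀ (q : ℕ) [NeZero q], q.Prime → q₀ ≤ q →
        (∀ n : ℕ, (n : ℝ) ≠ KMV2000.qhat q ^ Δ') →
          ‖upper q ρ P Q Δ'‖ ≤ C * KMV2000.qhat q * (Real.log (KMV2000.qhat q))⁻¹ ^ 3) :
    SubUpper ρ :=
  subOf_of_norm_le_window (fun q _ P Q Δ' ↦ upper q ρ P Q Δ') hΔ₀ h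

/-- **`stub_farP` from a window bound on the PRINT BAND alone** (`t = 0` on `(1, Δ₀]`): the Weil piece `SubFar rhoWeil` and
the glue `SubBand rhoP rhoWeil → SubFar rhoWeil → SubFar rhoP` are famedge-1's (imported by name where available); here only
the band half is packaged: a norm bound for `band q rhoP rhoWeil` on a short window gives `SubBand rhoP rhoWeil`. [folklore] -/
theorem subBand_rhoP_rhoWeil_of_norm_le_window {Δ₀ : ℝ} (hΔ₀ : 1 < Δ₀)
    (h : ∀ P Q : ℝ[X], KMV2000.Admissible P → KMV2000.IsEvenOrOdd Q → ∀ Δ' : ℝ, 1 < Δ' → Δ' ≤ Δ₀ →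
      ∃ C : ℝ, ∃ q₀ : ℕ, ∀ (q : ℕ) [NeZero q], q.Prime → q₀ ≤ q →
        (∀ n : ℕ, (n : ℝ) ≠ KMV2000.qhat q ^ Δ') →
          ‖band q rhoP rhoWeil P Q Δ'‖ ≤ C * KMV2000.qhat q * (Real.log (KMV2000.qhat q))⁻¹ ^ 3) :
    SubBand rhoP rhoWeil :=
  subBand_of_norm_le_window rhoP rhoWeil hΔ₀ h

end Summit.Parity.GeneralizedHardyLittlewood.Theorems.MomentsBeyondDiagonal.Layers

end
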